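import Summits.AtomisticToContinuum.BoseEinsteinCondensation.Theorems.BECThomsonPrincipleFibreConductanceStubThomsonHilbert
import Mathlib.Analysis.Normed.Module.HahnBanach
import Mathlib.Analysis.InnerProductSpace.Dual
import HarnessLib

/-!
# Route `BECThomsonPrinciple`, crux `FibreConductance` (stmt-AtomisticToContinuum-9480),
# line `healing-split-kinetic-defect` — stub `stub_thomson`: THE REALISATION HALF OF THOMSON DUALITY

`stub_thomson : Goal.stub_thomson` (`= ThomsonRealisation`): for a zero-free periodic `C¹` state `Φ`
(`L > 0`), a continuous charge `σ` and `D ≥ 0`, a DUAL BOUND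
`‖∫_{cellN} σ η‖² ≤ D · ∫_{cellN} |∇₀η|² ψ²/W` for every `C¹` periodic test function `η` PRODUCES a
measurable fibre flow `J` with weak `x₀`-divergence `σ` (`HasWeakDiv L J σ`) and Thomson cost
`∫|J|²W/ψ² ≤ D`.  Together with the lower-bound half `norm_pairing_sq_le` (disprover,
`Theorems/FibreConductance/Negative/FibreVocabulary.lean`) this is Thomson's principle for fibre flows:
the least cost of a flow of `σ` equals the squared `H⁻¹(ψ²/W dX)` norm of `σ`.

Proof (set-up in part I, `…StubThomsonHilbert.lean`).  `w := ψ²/W` is continuous, periodic, and bounded above and below by positive constants.  In the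
Hilbert space `H = L²(cellN; ℂ³)` (Mathlib `Lp (EuclideanSpace ℂ (Fin 3)) 2`) consider the linear map
`T : ζ ↦ √w·∇₀ζ` on the `ℂ`-space of test functions and the functional `Λ : ζ ↦ −∫ σ̄ζ`; the dual bound
applied to `η = ζ̄` reads `‖Λζ‖ ≤ √D‖Tζ‖`, so `Λ` descends to `range T`, extends to `H` with norm
`≤ √D` (Hahn–Banach, `exists_extension_norm_eq`) and is represented by `G ∈ H`, `‖G‖ ≤ √D` (Riesz,
`InnerProductSpace.toDual`).  `J := √w·G` (a measurable representative) has
`∫J·∇₀η = ⟪Tη̄, G⟫ = conj(Λη̄) = −∫ση` and `∫|J|²W/ψ² = ‖G‖² ≤ D`.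

References: R. Lyons, Y. Peres, *Probability on Trees and Networks* (2016), Ch. 2 §2.4 (Thomson's
principle) — the idea only; the functional analysis is Mathlib's.
-/

noncomputable section

namespace Summit.AtomisticToContinuum.BoseEinsteinCondensation.Cruxes.FibreConductance.HealingSplitKineticDefect

open MeasureTheory
open scoped ENNReal InnerProductSpace ComplexConjugate
open Literature.MathematicalPhysics.QuantumManyBody.BoseGas
open Summit.AtomisticToContinuum.BoseEinsteinCondensation.Cruxes.FibreConductance.ParsevalShellBootstrap

variable {m : ℕ} {L : ℝ}

/-! ## The functional `Λ` and its descent to `range T` -/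

variable {Φ : PeriodicTrialState (m + 1) L} {σ : Config (m + 1) → ℂ}

/-- The pairing `X ↦ σ̄ ζ` is integrable on the cell for continuous `σ` and test `ζ`. [folklore] -/
theorem th_integrable_pair (hσ : Continuous σ) {ζ : Config (m + 1) → ℂ} (hζ : IsTest L ζ) :
    Integrable (fun X => (starRingEnd ℂ) (σ X) * ζ X) (th_mu m L) :=
  integrableOn_cellN ((Complex.continuous_conj.comp hσ).mul hζ.1.continuous) L

/-- The functional `Λ : ζ ↦ −∫ σ̄ ζ` on test functions. [folklore] -/
def th_Lam (hσ : Continuous σ) : th_testSub m L →ₗ[ℂ] ℂ where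
  toFun ζ := -∫ X, (starRingEnd ℂ) (σ X) * (ζ : Config (m + 1) → ℂ) X ∂(th_mu m L)
  map_add' ζ₁ ζ₂ := by
    rw [← neg_add, ← integral_add (th_integrable_pair hσ ζ₁.2) (th_integrable_pair hσ ζ₂.2)]
    congr 1
    refine integral_congr_ae (ae_of_all _ fun X => ?_)
    simp only [Submodule.coe_add, Pi.add_apply, mul_add]
  map_smul' c ζ := by
    rw [RingHom.id_apply, smul_eq_mul, mul_neg, ← integral_const_mul]
    congr 1
    refine integral_congr_ae (ae_of_all _ fun X => ?_)
    simp only [Submodule.coe_smul, Pi.smul_apply, smul_eq_mul]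
    ring

/-- **The dual bound, transported to `H`**: `‖Λζ‖ ≤ √D‖Tζ‖` (the hypothesis applied to `η = ζ̄`).
[folklore] -/
theorem th_norm_Lam_le (hL : 0 < L) (hΦ : ∀ X, Φ.ψ X ≠ 0) (hσ : Continuous σ) {D : ℝ} (hD : 0 ≤ D)
    (hdual : HasDualBound Φ σ (ENNReal.ofReal D)) (ζ : th_testSub m L) :
    ‖th_Lam hσ ζ‖ ≤ Real.sqrt D * ‖th_T hL hΦ ζ‖ := by
  set η : Config (m + 1) → ℂ := fun X => (starRingEnd ℂ) ((ζ : Config (m + 1) → ℂ) X) with hη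
  have hηt : IsTest L η := IsTest.cconj ζ.2
  -- the pairing
  have h1 : ‖th_Lam hσ ζ‖ = ‖∫ X in cellN (m + 1) L, σ X * η X‖ := by
    change ‖-∫ X, (starRingEnd ℂ) (σ X) * (ζ : Config (m + 1) → ℂ) X ∂(th_mu m L)‖ = _
    rw [norm_neg, ← RCLike.norm_conj, ← integral_conj]
    congr 1
    refine integral_congr_ae (ae_of_all _ fun X => ?_)
    simp only [map_mul, RingHomCompTriple.comp_apply, RingHom.id_apply, hη]
  -- the dual energy
  have h2 : dualEnergy Φ η = ENNReal.ofReal (‖th_T hL hΦ ζ‖ ^ 2) := by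
    rw [← th_lintegral_T hL hΦ ζ]
    refine lintegral_congr_ae (ae_of_all _ fun X => ?_)
    simp only [hη, IsTest.fderiv_conj_apply, RCLike.norm_conj]
    rfl
  have h3 := hdual η hηt
  rw [← h1, h2, ← ENNReal.ofReal_mul hD, ENNReal.ofReal_le_ofReal_iff (by positivity)] at h3
  calc ‖th_Lam hσ ζ‖ ≤ Real.sqrt (D * ‖th_T hL hΦ ζ‖ ^ 2) :=
        (Real.le_sqrt (norm_nonneg _) (by positivity)).2 h3
    _ = Real.sqrt D * ‖th_T hL hΦ ζ‖ := by
        rw [Real.sqrt_mul hD, Real.sqrt_sq (norm_nonneg _)]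

/-- `Λ` is determined by `T`: `Tζ₁ = Tζ₂ ⇒ Λζ₁ = Λζ₂`. [folklore] -/
theorem th_Lam_eq_of_T_eq (hL : 0 < L) (hΦ : ∀ X, Φ.ψ X ≠ 0) (hσ : Continuous σ) {D : ℝ}
    (hD : 0 ≤ D) (hdual : HasDualBound Φ σ (ENNReal.ofReal D)) {ζ₁ ζ₂ : th_testSub m L}
    (h : th_T hL hΦ ζ₁ = th_T hL hΦ ζ₂) : th_Lam hσ ζ₁ = th_Lam hσ ζ₂ := by
  have := th_norm_Lam_le hL hΦ hσ hD hdual (ζ₁ - ζ₂)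
  rw [map_sub (th_T hL hΦ), h, sub_self, norm_zero, mul_zero, map_sub, norm_le_zero_iff,
    sub_eq_zero] at this
  exact this

/-- `Λ` descended to `range T ⊆ H` (well defined by `th_Lam_eq_of_T_eq`). [folklore] -/
def th_Lam0 (hL : 0 < L) (hΦ : ∀ X, Φ.ψ X ≠ 0) (hσ : Continuous σ) {D : ℝ} (hD : 0 ≤ D)
    (hdual : HasDualBound Φ σ (ENNReal.ofReal D)) :
    LinearMap.range (th_T hL hΦ (Φ := Φ)) →ₗ[ℂ] ℂ where
  toFun y := th_Lam hσ (Classical.choose (LinearMap.mem_range.1 y.2))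
  map_add' y₁ y₂ := by
    have e₁ := Classical.choose_spec (LinearMap.mem_range.1 y₁.2)
    have e₂ := Classical.choose_spec (LinearMap.mem_range.1 y₂.2)
    have e := Classical.choose_spec (LinearMap.mem_range.1 (y₁ + y₂).2)
    rw [← map_add (th_Lam hσ)]
    refine th_Lam_eq_of_T_eq hL hΦ hσ hD hdual ?_
    rw [map_add, e, e₁, e₂, Submodule.coe_add]
  map_smul' c y := by
    have e₁ := Classical.choose_spec (LinearMap.mem_range.1 y.2)
    have e := Classical.choose_spec (LinearMap.mem_range.1 (c • y).2)
    rw [RingHom.id_apply, ← map_smul (th_Lam hσ)]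
    refine th_Lam_eq_of_T_eq hL hΦ hσ hD hdual ?_
    rw [map_smul, e, e₁, Submodule.coe_smul]

/-- `Λ₀(Tζ) = Λζ`. [folklore] -/
theorem th_Lam0_apply (hL : 0 < L) (hΦ : ∀ X, Φ.ψ X ≠ 0) (hσ : Continuous σ) {D : ℝ} (hD : 0 ≤ D)
    (hdual : HasDualBound Φ σ (ENNReal.ofReal D)) (ζ : th_testSub m L)
    (hy : th_T hL hΦ ζ ∈ LinearMap.range (th_T hL hΦ (Φ := Φ))) :
    th_Lam0 hL hΦ hσ hD hdual ⟨th_T hL hΦ ζ, hy⟩ = th_Lam hσ ζ :=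
  th_Lam_eq_of_T_eq hL hΦ hσ hD hdual (Classical.choose_spec (LinearMap.mem_range.1 hy))

/-- `‖Λ₀ y‖ ≤ √D ‖y‖` on `range T`. [folklore] -/
theorem th_norm_Lam0_le (hL : 0 < L) (hΦ : ∀ X, Φ.ψ X ≠ 0) (hσ : Continuous σ) {D : ℝ}
    (hD : 0 ≤ D) (hdual : HasDualBound Φ σ (ENNReal.ofReal D))
    (y : LinearMap.range (th_T hL hΦ (Φ := Φ))) :
    ‖th_Lam0 hL hΦ hσ hD hdual y‖ ≤ Real.sqrt D * ‖y‖ := by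
  obtain ⟨ζ, hζ⟩ := LinearMap.mem_range.1 y.2
  have hy : y = ⟨th_T hL hΦ ζ, hζ ▸ y.2⟩ := Subtype.ext hζ.symm
  rw [hy, th_Lam0_apply]
  exact th_norm_Lam_le hL hΦ hσ hD hdual ζ

/-- `Λ₀` as a bounded functional on `range T`, `‖Λ₀‖ ≤ √D`. [folklore] -/
def th_Lam1 (hL : 0 < L) (hΦ : ∀ X, Φ.ψ X ≠ 0) (hσ : Continuous σ) {D : ℝ} (hD : 0 ≤ D)
    (hdual : HasDualBound Φ σ (ENNReal.ofReal D)) :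
    StrongDual ℂ (LinearMap.range (th_T hL hΦ (Φ := Φ))) :=
  (th_Lam0 hL hΦ hσ hD hdual).mkContinuous (Real.sqrt D) (th_norm_Lam0_le hL hΦ hσ hD hdual)

/-! ## The stub -/

/-- **Registered stub `stub_thomson` — THE REALISATION HALF OF THOMSON DUALITY** (`ThomsonRealisation`):
a dual bound `‖∫ση‖² ≤ D·∫|∇₀η|²ψ²/W` over `C¹` periodic `η` produces a measurable fibre flow of `σ`
of Thomson cost `≤ D` (Hahn–Banach + Riesz in `L²(cellN; ℂ³)`). [folklore] -/
theorem stub_thomson : Goal.stub_thomson := by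
  intro m L hL Φ hΦ σ hσ D hD hdual
  -- Hahn–Banach and Riesz
  obtain ⟨g, hg_ext, hg_norm⟩ :=
    exists_extension_norm_eq (LinearMap.range (th_T hL hΦ (Φ := Φ))) (th_Lam1 hL hΦ hσ hD hdual)
  set G : th_H m L := (InnerProductSpace.toDual ℂ (th_H m L)).symm g with hG
  have hGnorm : ‖G‖ ≤ Real.sqrt D := by
    rw [hG, LinearIsometryEquiv.norm_map, hg_norm]
    exact LinearMap.mkContinuous_norm_le _ (Real.sqrt_nonneg D) _
  -- a measurable representative, componentwise
  have hGl : ∀ l : Fin 3, AEStronglyMeasurable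
      (fun X => (G : Config (m + 1) → EuclideanSpace ℂ (Fin 3)) X l) (th_mu m L) :=
    fun l => (PiLp.continuous_apply 2 _ l).comp_aestronglyMeasurable (Lp.aestronglyMeasurable G)
  set gl : Fin 3 → Config (m + 1) → ℂ := fun l => (hGl l).mk _ with hgl
  have hae : ∀ᵐ X ∂(th_mu m L), ∀ l : Fin 3,
      (G : Config (m + 1) → EuclideanSpace ℂ (Fin 3)) X l = gl l X :=
    ae_all_iff.2 fun l => (hGl l).ae_eq_mk
  have hs : Continuous fun X => (Real.sqrt (th_wt Φ X) : ℂ) :=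
    Complex.continuous_ofReal.comp (continuous_th_wt hL hΦ).sqrt
  refine ⟨fun X l => (Real.sqrt (th_wt Φ X) : ℂ) * gl l X,
    measurable_pi_lambda _ fun l => hs.measurable.mul (hGl l).measurable_mk, ?_, ?_⟩
  · -- weak divergence
    intro η hη hper
    have hζt : IsTest L (fun X => (starRingEnd ℂ) (η X)) := IsTest.cconj ⟨hη, hper⟩
    set ζ : th_testSub m L := ⟨_, hζt⟩ with hζ
    have hmem : th_T hL hΦ ζ ∈ LinearMap.range (th_T hL hΦ (Φ := Φ)) := LinearMap.mem_range_self _ ζ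
    -- the pairing is `⟪Tζ, G⟫`
    have hpt : ∀ᵐ X ∂(th_mu m L), (∑ l : Fin 3, (Real.sqrt (th_wt Φ X) : ℂ) * gl l X *
        fderiv ℝ η X (Pi.single 0 (EuclideanSpace.single l (1 : ℝ)))) =
        ⟪(th_T hL hΦ ζ : Config (m + 1) → EuclideanSpace ℂ (Fin 3)) X,
          (G : Config (m + 1) → EuclideanSpace ℂ (Fin 3)) X⟫_ℂ := by
      filter_upwards [hae, th_T_ae hL hΦ ζ] with X hX hT
      rw [hT, PiLp.inner_apply]
      refine Finset.sum_congr rfl fun l _ => ?_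
      rw [RCLike.inner_apply, hX l]
      change _ = gl l X * (starRingEnd ℂ) ((Real.sqrt (th_wt Φ X) : ℂ) *
        fderiv ℝ (fun Y => (starRingEnd ℂ) (η Y)) X (e0 m l))
      rw [IsTest.fderiv_conj_apply, map_mul, Complex.conj_ofReal, RingHomCompTriple.comp_apply,
        RingHom.id_apply]
      simp only [e0]
      ring
    rw [integral_congr_ae hpt, ← L2.inner_def, ← inner_conj_symm,
      InnerProductSpace.toDual_symm_apply]
    have hgx := hg_ext ⟨th_T hL hΦ ζ, hmem⟩
    rw [Submodule.coe_mk] at hgx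
    rw [hgx]
    change (starRingEnd ℂ) (th_Lam0 hL hΦ hσ hD hdual ⟨th_T hL hΦ ζ, hmem⟩) = _
    rw [th_Lam0_apply hL hΦ hσ hD hdual ζ hmem]
    change (starRingEnd ℂ) (-∫ X, (starRingEnd ℂ) (σ X) * (starRingEnd ℂ) (η X) ∂(th_mu m L)) = _
    rw [map_neg, ← integral_conj]
    congr 1
    refine integral_congr_ae (ae_of_all _ fun X => ?_)
    simp only [map_mul, RingHomCompTriple.comp_apply, RingHom.id_apply]
  · -- cost
    have hpt : ∀ᵐ X ∂(th_mu m L), ENNReal.ofReal ((∑ l : Fin 3,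
        ‖(Real.sqrt (th_wt Φ X) : ℂ) * gl l X‖ ^ 2) * fibreW Φ X / fibrePsi Φ X ^ 2) =
        ENNReal.ofReal (‖(G : Config (m + 1) → EuclideanSpace ℂ (Fin 3)) X‖ ^ 2) := by
      filter_upwards [hae] with X hX
      congr 1
      rw [PiLp.norm_sq_eq_of_L2]
      have e : ∀ l : Fin 3, ‖(Real.sqrt (th_wt Φ X) : ℂ) * gl l X‖ ^ 2 =
          th_wt Φ X * ‖(G : Config (m + 1) → EuclideanSpace ℂ (Fin 3)) X l‖ ^ 2 := by
        intro l
        rw [norm_mul, mul_pow, Complex.norm_real, Real.norm_eq_abs, sq_abs,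
          Real.sq_sqrt (th_wt_pos hL hΦ X).le, hX l]
      simp_rw [e, ← Finset.mul_sum]
      exact th_wt_mul_weight hL hΦ X _
    calc fibreCost Φ _ = ∫⁻ X, ENNReal.ofReal
          (‖(G : Config (m + 1) → EuclideanSpace ℂ (Fin 3)) X‖ ^ 2) ∂(th_mu m L) :=
          lintegral_congr_ae hpt
      _ = ENNReal.ofReal (‖G‖ ^ 2) := th_lintegral_norm_sq G
      _ ≤ ENNReal.ofReal D := ENNReal.ofReal_le_ofReal (by
          calc ‖G‖ ^ 2 ≤ Real.sqrt D ^ 2 := pow_le_pow_left₀ (norm_nonneg _) hGnorm 2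
            _ = D := Real.sq_sqrt hD)

end Summit.AtomisticToContinuum.BoseEinsteinCondensation.Cruxes.FibreConductance.HealingSplitKineticDefect

end
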